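/-
Copyright (c) 2026 the pub-hodgecm-mathlib formalisation cell (harness21).  Prover seat hodgecm-mathlib-K2Liu-p09 (g5): Track B «K2-LIT»,
hLiu418 = stmt-HodgeConjecture-24832; LEAD F0P6-plan RULINGS M-156m∕o, M-157a∕c «A7 = GK COCYCLE ROAD», file B4d-2.
-/
import Summits.HodgeConjecture.HodgeConjecture.Theorems.K2LiuDoubledUTwoTwoUnipotentCoordinates   -- ★ B1b-2a (p03): frame, `toLocalFour`, letters
import Summits.HodgeConjecture.HodgeConjecture.Theorems.K2LiuDoubledUTwoTwoStepRelations         -- ★ B4c-3 (+ ★ B4c-2 partial Weyl letters, ★ B1a-3 `leviElt`)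
import HarnessLib

/-!
# Crux `HLiu418`, road `K2_Liu`, organ A7-reg (GK cocycle road), file B4d-2:
# THE SHORT-ROOT STEP IN `H_v`: the per-idempotent `SL₂` relation and the equivariance words of the partial Weyl letters, transported

Cell `hodgecm-mathlib`, crux item hLiu418 = `stmt-HodgeConjecture-24832`; squad K2 ∕ K2Liu; prover K2Liu-p09 (g5).
THEOREMS ONLY (no `def`, no instance, no notation, no named-fact hypothesis, no `sorry`); lane `--supports stmt-HodgeConjecture-24832`
(count-neutral helper).  ONE FRAME (RULING M-156o (c)): K2Liu-p03 (g6)'s ★ `U(J₄)(E ⊗ F_v)` letters through `φ := frameConj Q ∘ toLocalFour`.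

THE POINT.  The middle factor `A₁` of the cocycle `M = A₂ A₁ A₂` integrates over the Levi root line `u_{e₁−e₂}(z)`, `z ∈ E ⊗ F_v = Π_{w∣v} E_w`;
per place `w` it is the rank-one operator of the PARTIAL Weyl letter `P_ε = m(εW + (1−ε)1)`, `ε = ε_w` (★ B4c-2).  For ANY `F : H_v → ℂ` that is
(M) left-invariant under the transported Levi unipotents `φ(u_{e₁−e₂}(r))` and (T) a `θ`-eigenfunction of the transported torus, this file gives,
in the input shapes of ★ `K2LiuRankOneOperators`:
* §1 **`apply_partialWeyl_uMinus`** — `F(φ(P_ε) · φ(u₋(εt)) · g) = θ a b · F(φ(P_ε u₋(εt⁻¹) P_ε) · g)`, `a = 1 − ε − εt⁻¹`, `b = 1 − ε + εt`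
  (★ `leviElt_partialWeyl_mul_uMinus_eq`);
* §2 the words: `N_Δ`-clause `F(φ(P_ε)φ(u₋(y)) · φ(n(X)) · g) = F(φ(P_ε)φ(u₋(y)) · g)` for `F` invariant under all transported `n(X′)`
  (★ `leviElt_mul_nSiegelBlk`), the shift `φ(u₋(εt))φ(u₋(εb)) = φ(u₋(ε(t+b)))`, the other-component clause (`ε ε′ = 0`:
  `F(φ(P_ε)φ(u₋(εt)) · φ(u₋(ε′b)) · g) = F(φ(P_ε)φ(u₋(εt)) · g)`, ★ `leviElt_partialWeyl_mul_uMinus_comm`), and the torus word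
  `F(φ(P_ε)φ(u₋(z)) · φ(t(a,b)) · g) = θ a′ b′ · F(φ(P_ε)φ(u₋(b a⁻¹ z)) · g)` (★ `torusElt_mul_uMinus`, ★ `leviElt_partialWeyl_mul_torusElt`).
HONEST LABEL.  `HC_CM` is proved only modulo the 7 printed citations (2 remaining named inputs: hLiu418 = `stmt-HodgeConjecture-24832`,
h413 = `stmt-HodgeConjecture-24833`) until rung 0 closes.

## References
* [Casselman1980] W. Casselman, *The unramified principal series of p-adic groups I*, Compositio Math. 40 (1980), §3.
* [HarrisKudlaSweet1996] M. Harris, S. Kudla, W. J. Sweet, J. AMS 9 (1996), §1 (1.11)–(1.15), §6 (6.16) (the split-place factorisation of `L_E`).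
-/

set_option autoImplicit false
set_option linter.dupNamespace false -- the mandated namespace repeats `HodgeConjecture.HodgeConjecture`

noncomputable section

open NumberField IsDedekindDomain Matrix
open Literature.NumberTheory.Automorphic Literature.NumberTheory.Automorphic.UnitaryGroup
open Literature.NumberTheory.GelbartRogawski1991.AdaptedBlocks
open Literature.NumberTheory.GelbartRogawski1991.UnitaryDualPair.LocalSplitting
open Literature.NumberTheory.K2Lit.LocalSiegelDoubled
open Summit.HodgeConjecture.HodgeConjecture.Cruxes.HLiu418.K2LiuLocalSiegelIwasawaFrame
open Summit.HodgeConjecture.HodgeConjecture.Cruxes.HLiu418.K2LiuLocalSiegelIwasawa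
open Summit.HodgeConjecture.HodgeConjecture.Cruxes.HLiu418.K2LiuDoubledUTwoTwoBorelFrame
open Summit.HodgeConjecture.HodgeConjecture.Cruxes.HLiu418.K2LiuDoubledUTwoTwoWeylCocycle
open Summit.HodgeConjecture.HodgeConjecture.Cruxes.HLiu418.K2LiuDoubledUTwoTwoLevi
open Summit.HodgeConjecture.HodgeConjecture.Cruxes.HLiu418.K2LiuDoubledUTwoTwoFrameTransport
open Summit.HodgeConjecture.HodgeConjecture.Cruxes.HLiu418.K2LiuDoubledUTwoTwoRankOneRelationsLevi
open Summit.HodgeConjecture.HodgeConjecture.Cruxes.HLiu418.K2LiuDoubledUTwoTwoStepRelations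

namespace Summit.HodgeConjecture.HodgeConjecture.Cruxes.HLiu418.K2LiuSiegelCocycleStepShort

variable (F : Type) [Field F] [NumberField F] (E : Type) [Field E] [NumberField E] [Algebra F E]
  [Algebra.IsQuadraticExtension F E] (c : E ≃ₐ[F] E)
  {δ : E} (hcδ : c δ = -δ) (hδ : δ ≠ 0) (v : HeightOneSpectrum (𝓞 F))
  {T₂ : Matrix (Fin 2) (Fin 2) F} {J₂D : Matrix (Fin (2 + 2)) (Fin (2 + 2)) E} (hJ₂D : J₂D = (gramD F 2 T₂).map (algebraMap F E))
  (Q : GL (Fin (2 + 2)) F)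
  (hQ : (Q : Matrix (Fin (2 + 2)) (Fin (2 + 2)) F)ᵀ * gramD F 2 T₂ * (Q : Matrix (Fin (2 + 2)) (Fin (2 + 2)) F) = (StdForm.antidiagonal (2 + 2)).over F)

/-! ## §1 The short-root `SL₂` relation at an idempotent, in `H_v` -/

/-- **THE SHORT-ROOT RELATION IN `H_v` (per idempotent).**  For `F` left-invariant under the transported Levi root letters `φ(u_{e₁−e₂}(r))` and a
`θ`-eigenfunction of the transported torus, an idempotent `ε` (`ε² = ε`), `A ∈ GL₂` with matrix `(1−ε ε; ε 1−ε)`, a unit `t` and units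
`a = 1 − ε − εt⁻¹`, `b = 1 − ε + εt`:
`F(φ(P_ε) · φ(u₋(εt)) · g) = θ a b · F(φ(P_ε · u₋(εt⁻¹) · P_ε) · g)`. [cite: Casselman1980, §3] [cite: HarrisKudlaSweet1996, §6 (6.16)] -/
theorem apply_partialWeyl_uMinus (F' : UnitaryGroup.localPi E c (2 + 2) J₂D v → ℂ) (θ : (UnitaryGroup.LocalRing E v)ˣ → (UnitaryGroup.LocalRing E v)ˣ → ℂ)
    (hM : ∀ (r : UnitaryGroup.LocalRing E v) (g : UnitaryGroup.localPi E c (2 + 2) J₂D v), F' (FrameTransport.frameConj F E c v (2 + 2) hJ₂D (antidiagonal_over_eq_map F E 2) Q hQ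
          (toLocalFour F E c v (uMinus (UnitaryGroup.LocalRing E v) (UnitaryGroup.conjLocal E c v) (UnitaryGroup.conjLocal_conjLocal c v hcδ hδ) r)) * g) = F' g)
    (hT : ∀ (a b : (UnitaryGroup.LocalRing E v)ˣ) (g : UnitaryGroup.localPi E c (2 + 2) J₂D v), F' (FrameTransport.frameConj F E c v (2 + 2) hJ₂D (antidiagonal_over_eq_map F E 2) Q hQ
          (toLocalFour F E c v (torusElt (UnitaryGroup.LocalRing E v) (UnitaryGroup.conjLocal E c v) (UnitaryGroup.conjLocal_conjLocal c v hcδ hδ) a b)) * g) = θ a b * F' g)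
    {ε : UnitaryGroup.LocalRing E v} (hε : ε * ε = ε) (t : (UnitaryGroup.LocalRing E v)ˣ)
    (A : GL (Fin 2) (UnitaryGroup.LocalRing E v)) (hA : A.val = !![1 - ε, ε; ε, 1 - ε])
    (a b : (UnitaryGroup.LocalRing E v)ˣ) (ha : (a : UnitaryGroup.LocalRing E v) = 1 - ε - ε * ((t⁻¹ : (UnitaryGroup.LocalRing E v)ˣ) : UnitaryGroup.LocalRing E v))
    (hb : (b : UnitaryGroup.LocalRing E v) = 1 - ε + ε * (t : UnitaryGroup.LocalRing E v)) (g : UnitaryGroup.localPi E c (2 + 2) J₂D v) :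
    F' (FrameTransport.frameConj F E c v (2 + 2) hJ₂D (antidiagonal_over_eq_map F E 2) Q hQ
          (toLocalFour F E c v (leviElt (UnitaryGroup.LocalRing E v) (UnitaryGroup.conjLocal E c v) (UnitaryGroup.conjLocal_conjLocal c v hcδ hδ) A)) *
        FrameTransport.frameConj F E c v (2 + 2) hJ₂D (antidiagonal_over_eq_map F E 2) Q hQ
          (toLocalFour F E c v (uMinus (UnitaryGroup.LocalRing E v) (UnitaryGroup.conjLocal E c v) (UnitaryGroup.conjLocal_conjLocal c v hcδ hδ) (ε * (t : UnitaryGroup.LocalRing E v)))) * g) =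
      θ a b * F' (FrameTransport.frameConj F E c v (2 + 2) hJ₂D (antidiagonal_over_eq_map F E 2) Q hQ
          (toLocalFour F E c v (leviElt (UnitaryGroup.LocalRing E v) (UnitaryGroup.conjLocal E c v) (UnitaryGroup.conjLocal_conjLocal c v hcδ hδ) A * uMinus (UnitaryGroup.LocalRing E v) (UnitaryGroup.conjLocal E c v) (UnitaryGroup.conjLocal_conjLocal c v hcδ hδ) (ε * ((t⁻¹ : (UnitaryGroup.LocalRing E v)ˣ) : UnitaryGroup.LocalRing E v)) *
            leviElt (UnitaryGroup.LocalRing E v) (UnitaryGroup.conjLocal E c v) (UnitaryGroup.conjLocal_conjLocal c v hcδ hδ) A)) * g) := by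
  have hrel := congrArg (fun g' => FrameTransport.frameConj F E c v (2 + 2) hJ₂D (antidiagonal_over_eq_map F E 2) Q hQ (toLocalFour F E c v g') * g)
    (leviElt_partialWeyl_mul_uMinus_eq (R := UnitaryGroup.LocalRing E v) (σ := UnitaryGroup.conjLocal E c v) (UnitaryGroup.conjLocal_conjLocal c v hcδ hδ) hε t A hA a b ha hb)
  simp only [map_mul, mul_assoc] at hrel ⊢
  rw [hrel, hM, hT]

/-! ## §2 The equivariance words of the short-root step -/

/-- **the `N_Δ`-clause**: for `F` invariant under every transported Siegel unipotent `φ(n(X))`: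
`F(φ(P)φ(u₋(y)) · φ(n(X)) · g) = F(φ(P)φ(u₋(y)) · g)` for any Levi letter `P = m(A)` (★ `leviElt_mul_nSiegelBlk`: `m(B) n(X) = n(X′) m(B)` with `B = A·U(y)`).
[cite: HarrisKudlaSweet1996, §1 (1.11)] -/
theorem apply_leviElt_uMinus_mul_nSiegelBlk (F' : UnitaryGroup.localPi E c (2 + 2) J₂D v → ℂ)
    (hN : ∀ (X : Matrix (Fin 2) (Fin 2) (UnitaryGroup.LocalRing E v)) (hX : IsSkewTwo (UnitaryGroup.LocalRing E v) (UnitaryGroup.conjLocal E c v) X) (g : UnitaryGroup.localPi E c (2 + 2) J₂D v),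
      F' (FrameTransport.frameConj F E c v (2 + 2) hJ₂D (antidiagonal_over_eq_map F E 2) Q hQ (toLocalFour F E c v (nSiegelBlk (UnitaryGroup.LocalRing E v) (UnitaryGroup.conjLocal E c v) hX)) * g) = F' g)
    (A : GL (Fin 2) (UnitaryGroup.LocalRing E v)) (y : UnitaryGroup.LocalRing E v) (X : Matrix (Fin 2) (Fin 2) (UnitaryGroup.LocalRing E v)) (hX : IsSkewTwo (UnitaryGroup.LocalRing E v) (UnitaryGroup.conjLocal E c v) X) (g : UnitaryGroup.localPi E c (2 + 2) J₂D v) :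
    F' (FrameTransport.frameConj F E c v (2 + 2) hJ₂D (antidiagonal_over_eq_map F E 2) Q hQ
          (toLocalFour F E c v (leviElt (UnitaryGroup.LocalRing E v) (UnitaryGroup.conjLocal E c v) (UnitaryGroup.conjLocal_conjLocal c v hcδ hδ) A)) * FrameTransport.frameConj F E c v (2 + 2) hJ₂D (antidiagonal_over_eq_map F E 2) Q hQ
          (toLocalFour F E c v (uMinus (UnitaryGroup.LocalRing E v) (UnitaryGroup.conjLocal E c v) (UnitaryGroup.conjLocal_conjLocal c v hcδ hδ) y)) *
        (FrameTransport.frameConj F E c v (2 + 2) hJ₂D (antidiagonal_over_eq_map F E 2) Q hQ (toLocalFour F E c v (nSiegelBlk (UnitaryGroup.LocalRing E v) (UnitaryGroup.conjLocal E c v) hX)) * g)) =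
      F' (FrameTransport.frameConj F E c v (2 + 2) hJ₂D (antidiagonal_over_eq_map F E 2) Q hQ
          (toLocalFour F E c v (leviElt (UnitaryGroup.LocalRing E v) (UnitaryGroup.conjLocal E c v) (UnitaryGroup.conjLocal_conjLocal c v hcδ hδ) A)) * FrameTransport.frameConj F E c v (2 + 2) hJ₂D (antidiagonal_over_eq_map F E 2) Q hQ
          (toLocalFour F E c v (uMinus (UnitaryGroup.LocalRing E v) (UnitaryGroup.conjLocal E c v) (UnitaryGroup.conjLocal_conjLocal c v hcδ hδ) y)) * g) := by
  -- `u₋(y) = m(U)`, `U = (1 y; 0 1)`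
  let U : GL (Fin 2) (UnitaryGroup.LocalRing E v) := ⟨!![1, y; 0, 1], !![1, -y; 0, 1],
    by ext i j; fin_cases i <;> fin_cases j <;> simp [Matrix.mul_apply, Fin.sum_univ_two],
    by ext i j; fin_cases i <;> fin_cases j <;> simp [Matrix.mul_apply, Fin.sum_univ_two]⟩
  have hU : uMinus (UnitaryGroup.LocalRing E v) (UnitaryGroup.conjLocal E c v) (UnitaryGroup.conjLocal_conjLocal c v hcδ hδ) y = leviElt (UnitaryGroup.LocalRing E v) (UnitaryGroup.conjLocal E c v) (UnitaryGroup.conjLocal_conjLocal c v hcδ hδ) U := (leviElt_eq_uMinus (UnitaryGroup.conjLocal_conjLocal c v hcδ hδ) y U rfl).symm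
  have hword : leviElt (UnitaryGroup.LocalRing E v) (UnitaryGroup.conjLocal E c v) (UnitaryGroup.conjLocal_conjLocal c v hcδ hδ) A * uMinus (UnitaryGroup.LocalRing E v) (UnitaryGroup.conjLocal E c v) (UnitaryGroup.conjLocal_conjLocal c v hcδ hδ) y * nSiegelBlk (UnitaryGroup.LocalRing E v) (UnitaryGroup.conjLocal E c v) hX =
      nSiegelBlk (UnitaryGroup.LocalRing E v) (UnitaryGroup.conjLocal E c v) (hX.conj (UnitaryGroup.conjLocal_conjLocal c v hcδ hδ) (A * U).val) *
        (leviElt (UnitaryGroup.LocalRing E v) (UnitaryGroup.conjLocal E c v) (UnitaryGroup.conjLocal_conjLocal c v hcδ hδ) A * uMinus (UnitaryGroup.LocalRing E v) (UnitaryGroup.conjLocal E c v) (UnitaryGroup.conjLocal_conjLocal c v hcδ hδ) y) := by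
    rw [hU, leviElt_mul, leviElt_mul_nSiegelBlk]
  have h := congrArg (fun g' => FrameTransport.frameConj F E c v (2 + 2) hJ₂D (antidiagonal_over_eq_map F E 2) Q hQ (toLocalFour F E c v g') * g) hword
  simp only [map_mul, mul_assoc] at h ⊢
  rw [h, hN]

/-- **the shift word**: `φ(P)φ(u₋(εt)) · φ(u₋(εb)) · g = φ(P)φ(u₋(ε(t + b))) · g` (★ `uMinus_mul`). [cite: Casselman1980, §3] -/
theorem leviElt_uMinus_mul_uMinus_apply (A : GL (Fin 2) (UnitaryGroup.LocalRing E v)) (ε t b : UnitaryGroup.LocalRing E v) (g : UnitaryGroup.localPi E c (2 + 2) J₂D v) :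
    FrameTransport.frameConj F E c v (2 + 2) hJ₂D (antidiagonal_over_eq_map F E 2) Q hQ
          (toLocalFour F E c v (leviElt (UnitaryGroup.LocalRing E v) (UnitaryGroup.conjLocal E c v) (UnitaryGroup.conjLocal_conjLocal c v hcδ hδ) A)) * FrameTransport.frameConj F E c v (2 + 2) hJ₂D (antidiagonal_over_eq_map F E 2) Q hQ
          (toLocalFour F E c v (uMinus (UnitaryGroup.LocalRing E v) (UnitaryGroup.conjLocal E c v) (UnitaryGroup.conjLocal_conjLocal c v hcδ hδ) (ε * t))) * (FrameTransport.frameConj F E c v (2 + 2) hJ₂D (antidiagonal_over_eq_map F E 2) Q hQ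
          (toLocalFour F E c v (uMinus (UnitaryGroup.LocalRing E v) (UnitaryGroup.conjLocal E c v) (UnitaryGroup.conjLocal_conjLocal c v hcδ hδ) (ε * b))) * g) =
      FrameTransport.frameConj F E c v (2 + 2) hJ₂D (antidiagonal_over_eq_map F E 2) Q hQ
          (toLocalFour F E c v (leviElt (UnitaryGroup.LocalRing E v) (UnitaryGroup.conjLocal E c v) (UnitaryGroup.conjLocal_conjLocal c v hcδ hδ) A)) * FrameTransport.frameConj F E c v (2 + 2) hJ₂D (antidiagonal_over_eq_map F E 2) Q hQ
          (toLocalFour F E c v (uMinus (UnitaryGroup.LocalRing E v) (UnitaryGroup.conjLocal E c v) (UnitaryGroup.conjLocal_conjLocal c v hcδ hδ) (ε * (t + b)))) * g := by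
  have hword : leviElt (UnitaryGroup.LocalRing E v) (UnitaryGroup.conjLocal E c v) (UnitaryGroup.conjLocal_conjLocal c v hcδ hδ) A * uMinus (UnitaryGroup.LocalRing E v) (UnitaryGroup.conjLocal E c v) (UnitaryGroup.conjLocal_conjLocal c v hcδ hδ) (ε * t) * uMinus (UnitaryGroup.LocalRing E v) (UnitaryGroup.conjLocal E c v) (UnitaryGroup.conjLocal_conjLocal c v hcδ hδ) (ε * b) =
      leviElt (UnitaryGroup.LocalRing E v) (UnitaryGroup.conjLocal E c v) (UnitaryGroup.conjLocal_conjLocal c v hcδ hδ) A * uMinus (UnitaryGroup.LocalRing E v) (UnitaryGroup.conjLocal E c v) (UnitaryGroup.conjLocal_conjLocal c v hcδ hδ) (ε * (t + b)) := by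
    rw [mul_assoc, uMinus_mul, mul_add]
  have h := congrArg (fun g' => FrameTransport.frameConj F E c v (2 + 2) hJ₂D (antidiagonal_over_eq_map F E 2) Q hQ (toLocalFour F E c v g') * g) hword
  simp only [map_mul, mul_assoc] at h ⊢
  rw [h]

/-- **the other-component clause** (`ε ε′ = 0`): for `F` invariant under the Levi root letters,
`F(φ(P_ε)φ(u₋(εt)) · φ(u₋(ε′b)) · g) = F(φ(P_ε)φ(u₋(εt)) · g)` (`u₋(εt)u₋(ε′b) = u₋(ε′b)u₋(εt)` and ★ `leviElt_partialWeyl_mul_uMinus_comm`).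
[cite: HarrisKudlaSweet1996, §6 (6.16)] -/
theorem apply_partialWeyl_uMinus_mul_uMinus_other (F' : UnitaryGroup.localPi E c (2 + 2) J₂D v → ℂ)
    (hM : ∀ (r : UnitaryGroup.LocalRing E v) (g : UnitaryGroup.localPi E c (2 + 2) J₂D v), F' (FrameTransport.frameConj F E c v (2 + 2) hJ₂D (antidiagonal_over_eq_map F E 2) Q hQ
          (toLocalFour F E c v (uMinus (UnitaryGroup.LocalRing E v) (UnitaryGroup.conjLocal E c v) (UnitaryGroup.conjLocal_conjLocal c v hcδ hδ) r)) * g) = F' g)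
    {ε ε' : UnitaryGroup.LocalRing E v} (hεε' : ε * ε' = 0)
    (A : GL (Fin 2) (UnitaryGroup.LocalRing E v)) (hA : A.val = !![1 - ε, ε; ε, 1 - ε]) (t b : UnitaryGroup.LocalRing E v) (g : UnitaryGroup.localPi E c (2 + 2) J₂D v) :
    F' (FrameTransport.frameConj F E c v (2 + 2) hJ₂D (antidiagonal_over_eq_map F E 2) Q hQ
          (toLocalFour F E c v (leviElt (UnitaryGroup.LocalRing E v) (UnitaryGroup.conjLocal E c v) (UnitaryGroup.conjLocal_conjLocal c v hcδ hδ) A)) * FrameTransport.frameConj F E c v (2 + 2) hJ₂D (antidiagonal_over_eq_map F E 2) Q hQ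
          (toLocalFour F E c v (uMinus (UnitaryGroup.LocalRing E v) (UnitaryGroup.conjLocal E c v) (UnitaryGroup.conjLocal_conjLocal c v hcδ hδ) (ε * t))) * (FrameTransport.frameConj F E c v (2 + 2) hJ₂D (antidiagonal_over_eq_map F E 2) Q hQ
          (toLocalFour F E c v (uMinus (UnitaryGroup.LocalRing E v) (UnitaryGroup.conjLocal E c v) (UnitaryGroup.conjLocal_conjLocal c v hcδ hδ) (ε' * b))) * g)) =
      F' (FrameTransport.frameConj F E c v (2 + 2) hJ₂D (antidiagonal_over_eq_map F E 2) Q hQ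
          (toLocalFour F E c v (leviElt (UnitaryGroup.LocalRing E v) (UnitaryGroup.conjLocal E c v) (UnitaryGroup.conjLocal_conjLocal c v hcδ hδ) A)) * FrameTransport.frameConj F E c v (2 + 2) hJ₂D (antidiagonal_over_eq_map F E 2) Q hQ
          (toLocalFour F E c v (uMinus (UnitaryGroup.LocalRing E v) (UnitaryGroup.conjLocal E c v) (UnitaryGroup.conjLocal_conjLocal c v hcδ hδ) (ε * t))) * g) := by
  have hword : leviElt (UnitaryGroup.LocalRing E v) (UnitaryGroup.conjLocal E c v) (UnitaryGroup.conjLocal_conjLocal c v hcδ hδ) A * uMinus (UnitaryGroup.LocalRing E v) (UnitaryGroup.conjLocal E c v) (UnitaryGroup.conjLocal_conjLocal c v hcδ hδ) (ε * t) * uMinus (UnitaryGroup.LocalRing E v) (UnitaryGroup.conjLocal E c v) (UnitaryGroup.conjLocal_conjLocal c v hcδ hδ) (ε' * b) =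
      uMinus (UnitaryGroup.LocalRing E v) (UnitaryGroup.conjLocal E c v) (UnitaryGroup.conjLocal_conjLocal c v hcδ hδ) (ε' * b) * (leviElt (UnitaryGroup.LocalRing E v) (UnitaryGroup.conjLocal E c v) (UnitaryGroup.conjLocal_conjLocal c v hcδ hδ) A * uMinus (UnitaryGroup.LocalRing E v) (UnitaryGroup.conjLocal E c v) (UnitaryGroup.conjLocal_conjLocal c v hcδ hδ) (ε * t)) := by
    rw [mul_assoc, uMinus_mul, add_comm, ← uMinus_mul, ← mul_assoc, leviElt_partialWeyl_mul_uMinus_comm (UnitaryGroup.conjLocal_conjLocal c v hcδ hδ) hεε' b A hA, mul_assoc]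
  have h := congrArg (fun g' => FrameTransport.frameConj F E c v (2 + 2) hJ₂D (antidiagonal_over_eq_map F E 2) Q hQ (toLocalFour F E c v g') * g) hword
  simp only [map_mul, mul_assoc] at h ⊢
  rw [h, hM]

/-- **the torus word of the short-root step**: for a `θ`-eigenfunction `F`,
`F(φ(P_ε)φ(u₋(z)) · φ(t(a,b)) · g) = θ a′ b′ · F(φ(P_ε)φ(u₋(b a⁻¹ z)) · g)` with `a′ = (1−ε)a + εb`, `b′ = (1−ε)b + εa`
(★ `torusElt_mul_uMinus`, ★ `leviElt_partialWeyl_mul_torusElt`). [cite: Casselman1980, §3] -/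
theorem apply_partialWeyl_uMinus_mul_torusElt (F' : UnitaryGroup.localPi E c (2 + 2) J₂D v → ℂ) (θ : (UnitaryGroup.LocalRing E v)ˣ → (UnitaryGroup.LocalRing E v)ˣ → ℂ)
    (hT : ∀ (a b : (UnitaryGroup.LocalRing E v)ˣ) (g : UnitaryGroup.localPi E c (2 + 2) J₂D v), F' (FrameTransport.frameConj F E c v (2 + 2) hJ₂D (antidiagonal_over_eq_map F E 2) Q hQ
          (toLocalFour F E c v (torusElt (UnitaryGroup.LocalRing E v) (UnitaryGroup.conjLocal E c v) (UnitaryGroup.conjLocal_conjLocal c v hcδ hδ) a b)) * g) = θ a b * F' g)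
    {ε : UnitaryGroup.LocalRing E v} (hε : ε * ε = ε)
    (A : GL (Fin 2) (UnitaryGroup.LocalRing E v)) (hA : A.val = !![1 - ε, ε; ε, 1 - ε]) (z : UnitaryGroup.LocalRing E v)
    (a b a' b' : (UnitaryGroup.LocalRing E v)ˣ) (ha' : (a' : UnitaryGroup.LocalRing E v) = (1 - ε) * a + ε * b) (hb' : (b' : UnitaryGroup.LocalRing E v) = (1 - ε) * b + ε * a)
    (g : UnitaryGroup.localPi E c (2 + 2) J₂D v) :
    F' (FrameTransport.frameConj F E c v (2 + 2) hJ₂D (antidiagonal_over_eq_map F E 2) Q hQ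
          (toLocalFour F E c v (leviElt (UnitaryGroup.LocalRing E v) (UnitaryGroup.conjLocal E c v) (UnitaryGroup.conjLocal_conjLocal c v hcδ hδ) A)) * FrameTransport.frameConj F E c v (2 + 2) hJ₂D (antidiagonal_over_eq_map F E 2) Q hQ
          (toLocalFour F E c v (uMinus (UnitaryGroup.LocalRing E v) (UnitaryGroup.conjLocal E c v) (UnitaryGroup.conjLocal_conjLocal c v hcδ hδ) z)) * (FrameTransport.frameConj F E c v (2 + 2) hJ₂D (antidiagonal_over_eq_map F E 2) Q hQ
          (toLocalFour F E c v (torusElt (UnitaryGroup.LocalRing E v) (UnitaryGroup.conjLocal E c v) (UnitaryGroup.conjLocal_conjLocal c v hcδ hδ) a b)) * g)) =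
      θ a' b' * F' (FrameTransport.frameConj F E c v (2 + 2) hJ₂D (antidiagonal_over_eq_map F E 2) Q hQ
          (toLocalFour F E c v (leviElt (UnitaryGroup.LocalRing E v) (UnitaryGroup.conjLocal E c v) (UnitaryGroup.conjLocal_conjLocal c v hcδ hδ) A)) *
        FrameTransport.frameConj F E c v (2 + 2) hJ₂D (antidiagonal_over_eq_map F E 2) Q hQ
          (toLocalFour F E c v (uMinus (UnitaryGroup.LocalRing E v) (UnitaryGroup.conjLocal E c v) (UnitaryGroup.conjLocal_conjLocal c v hcδ hδ) ((b : UnitaryGroup.LocalRing E v) * ((a⁻¹ : (UnitaryGroup.LocalRing E v)ˣ) : UnitaryGroup.LocalRing E v) * z))) * g) := by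
  -- `u₋(z) t(a,b) = t(a,b) u₋(b a⁻¹ z)` (★ `torusElt_mul_uMinus` read backwards), then `P_ε t(a,b) = t(a′,b′) P_ε`
  have h1 : uMinus (UnitaryGroup.LocalRing E v) (UnitaryGroup.conjLocal E c v) (UnitaryGroup.conjLocal_conjLocal c v hcδ hδ) z * torusElt (UnitaryGroup.LocalRing E v) (UnitaryGroup.conjLocal E c v) (UnitaryGroup.conjLocal_conjLocal c v hcδ hδ) a b =
      torusElt (UnitaryGroup.LocalRing E v) (UnitaryGroup.conjLocal E c v) (UnitaryGroup.conjLocal_conjLocal c v hcδ hδ) a b *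
        uMinus (UnitaryGroup.LocalRing E v) (UnitaryGroup.conjLocal E c v) (UnitaryGroup.conjLocal_conjLocal c v hcδ hδ) ((b : UnitaryGroup.LocalRing E v) * ((a⁻¹ : (UnitaryGroup.LocalRing E v)ˣ) : UnitaryGroup.LocalRing E v) * z) := by
    rw [torusElt_mul_uMinus]
    congr 2
    rw [← mul_assoc, ← mul_assoc, show (a : UnitaryGroup.LocalRing E v) * ((b⁻¹ : (UnitaryGroup.LocalRing E v)ˣ) : UnitaryGroup.LocalRing E v) * (b : UnitaryGroup.LocalRing E v) *
      ((a⁻¹ : (UnitaryGroup.LocalRing E v)ˣ) : UnitaryGroup.LocalRing E v) = 1 by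
        rw [mul_assoc (a : UnitaryGroup.LocalRing E v), Units.inv_mul, mul_one, Units.mul_inv], one_mul]
  have hword : leviElt (UnitaryGroup.LocalRing E v) (UnitaryGroup.conjLocal E c v) (UnitaryGroup.conjLocal_conjLocal c v hcδ hδ) A * uMinus (UnitaryGroup.LocalRing E v) (UnitaryGroup.conjLocal E c v) (UnitaryGroup.conjLocal_conjLocal c v hcδ hδ) z * torusElt (UnitaryGroup.LocalRing E v) (UnitaryGroup.conjLocal E c v) (UnitaryGroup.conjLocal_conjLocal c v hcδ hδ) a b =
      torusElt (UnitaryGroup.LocalRing E v) (UnitaryGroup.conjLocal E c v) (UnitaryGroup.conjLocal_conjLocal c v hcδ hδ) a' b' * (leviElt (UnitaryGroup.LocalRing E v) (UnitaryGroup.conjLocal E c v) (UnitaryGroup.conjLocal_conjLocal c v hcδ hδ) A *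
        uMinus (UnitaryGroup.LocalRing E v) (UnitaryGroup.conjLocal E c v) (UnitaryGroup.conjLocal_conjLocal c v hcδ hδ) ((b : UnitaryGroup.LocalRing E v) * ((a⁻¹ : (UnitaryGroup.LocalRing E v)ˣ) : UnitaryGroup.LocalRing E v) * z)) := by
    rw [mul_assoc, h1, ← mul_assoc, leviElt_partialWeyl_mul_torusElt (UnitaryGroup.conjLocal_conjLocal c v hcδ hδ) hε A hA a b a' b' ha' hb', mul_assoc]
  have h := congrArg (fun g' => FrameTransport.frameConj F E c v (2 + 2) hJ₂D (antidiagonal_over_eq_map F E 2) Q hQ (toLocalFour F E c v g') * g) hword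
  simp only [map_mul, mul_assoc] at h ⊢
  rw [h, hT]

end Summit.HodgeConjecture.HodgeConjecture.Cruxes.HLiu418.K2LiuSiegelCocycleStepShort

end
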